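/-
Copyright (c) 2026 the pub-hodgecm-mathlib formalisation cell (harness21).  Prover seat hodgecm-mathlib-K2Liu-p09 (g5): Track B «K2-LIT»,
hLiu418 = stmt-HodgeConjecture-24832; LEAD F0P6-plan (g12) RULINGS M-156m∕M-156o «A7 = GK COCYCLE ROAD», file B4c-1 (algebra for B4-concrete).
-/
import Summits.HodgeConjecture.HodgeConjecture.Theorems.K2LiuDoubledUTwoTwoWeylCocycle   -- ★ B1a-1∕B1a-2 (K2Liu-p03): letters, torus, Weyl letters
import HarnessLib

/-!
# Crux `HLiu418`, road `K2_Liu`, organ A7-reg (GK cocycle road), file B4c-1: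
# THE RANK-ONE `SL₂` RELATION FOR THE LONG SIMPLE ROOT `α₂ = 2e₂` OF `U(J₄)` and the commutation facts the `α₂`-operator uses

Cell `hodgecm-mathlib`, crux item hLiu418 = `stmt-HodgeConjecture-24832`; squad K2 ∕ K2Liu; prover K2Liu-p09 (g5).
THEOREMS ONLY (no `def`, no instance, no notation, no named-fact hypothesis, no `sorry`); lane `--supports stmt-HodgeConjecture-24832`
(count-neutral helper).  Pure algebra over a commutative ring `R` with an involution `σ`, on K2Liu-p03 (g6)'s ★ letters (RULING M-156o (c):
ONE frame; the per-place transport to `H_v` is ★∕📤 B1b).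

* §1 **`weylTwo_mul_uLongTwo_eq`** — for a SKEW UNIT `x` (`σ x = −x`):
  `w₂ · u_{2e₂}(x) = u_{2e₂}(x⁻¹) · t(1, −x⁻¹) · (w₂ u_{2e₂}(x⁻¹) w₂)`,
  the `SL₂` identity `(0 1; 1 x) = (1 x⁻¹; 0 1)(−x⁻¹ 0; 0 x)(1 0; x⁻¹ 1)` in the `(e₂, f₂)`-plane (`t(1, −x⁻¹) = diag(1, −x⁻¹, x, 1)` IS unitary
  because `x` is skew).  This is the hypothesis `hrel` of ★ `K2LiuRankOneOperators.integrable_and_integral_eq` for the `α₂`-steps of the cocycle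
  `M = A₂ A₁ A₂`: left of `w₂ u(x)` stand an element of `N_Δ` (where Siegel sections are invariant) and a torus element (where they transform by
  the inducing character), right of it the OPPOSITE root letter `ū_{2e₂}(x⁻¹) = w₂ u_{2e₂}(x⁻¹) w₂`, small when `x` is large.
* §2 the opposite letter is a conjugate of the root letter (`ū(r) = w₂ u(r) w₂`, so `ū(0) = 1`, `ū` additive), and `w₂ u(x) u(b) = w₂ u(x + b)`
  (the shift clause); the torus clause `w₂ u(x) t(a,b) = t(a, σ(b)⁻¹) · w₂ u((b σ b)⁻¹ x)` is assembled from ★ `torusElt_mul_uLongTwo` and ★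
  `weylTwo_mul_torusElt` in B4-concrete.
HONEST LABEL.  `HC_CM` is proved only modulo the 7 printed citations (2 remaining named inputs: hLiu418 = `stmt-HodgeConjecture-24832`,
h413 = `stmt-HodgeConjecture-24833`) until rung 0 closes.

## References
* [Casselman1980] W. Casselman, *The unramified principal series of p-adic groups I*, Compositio Math. 40 (1980), §3 (rank-one reduction `w u(x) = u(x⁻¹) α^∨(x) ū(x⁻¹)`).
* [Rogawski1990] J. Rogawski, *Automorphic representations of unitary groups in three variables* (1990), §1.9 (root subgroups of quasi-split unitary groups).
* [Mok2014] C. P. Mok, Mem. AMS 235 (2015), §1 (the form `J_N`).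
-/

set_option autoImplicit false
set_option linter.dupNamespace false -- the mandated namespace repeats `HodgeConjecture.HodgeConjecture`

noncomputable section

open Matrix
open Literature.NumberTheory.Automorphic
open Summit.HodgeConjecture.HodgeConjecture.Cruxes.HLiu418.K2LiuDoubledUTwoTwoBorelFrame
open Summit.HodgeConjecture.HodgeConjecture.Cruxes.HLiu418.K2LiuDoubledUTwoTwoWeylCocycle

namespace Summit.HodgeConjecture.HodgeConjecture.Cruxes.HLiu418.K2LiuDoubledUTwoTwoRankOneRelations

variable (R : Type*) [CommRing R] (σ : R →+* R)

/-! ## §1 The `SL₂` relation of the long simple root `α₂ = 2e₂` -/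

variable {R σ} in
/-- the inverse of a skew unit is skew: `σ(x⁻¹) = −x⁻¹`. [cite: Rogawski1990, §1.9] -/
theorem skew_inv {x : Rˣ} (hx : σ (x : R) = -(x : R)) : σ ((x⁻¹ : Rˣ) : R) = -((x⁻¹ : Rˣ) : R) := by
  have h1 : σ ((x⁻¹ : Rˣ) : R) * σ (x : R) = 1 := by rw [← map_mul, Units.inv_mul, map_one]
  rw [hx, mul_neg, neg_eq_iff_eq_neg] at h1
  -- `σ(x⁻¹) · x = −1`, so `σ(x⁻¹) = −x⁻¹`
  calc σ ((x⁻¹ : Rˣ) : R) = σ ((x⁻¹ : Rˣ) : R) * (x : R) * ((x⁻¹ : Rˣ) : R) := by rw [mul_assoc, Units.mul_inv, mul_one]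
    _ = -((x⁻¹ : Rˣ) : R) := by rw [h1, neg_one_mul]

/-- **THE `SL₂` RELATION FOR `α₂`.**  For a skew unit `x` (`σ x = −x`):
`w₂ · u_{2e₂}(x) = u_{2e₂}(x⁻¹) · t(1, −x⁻¹) · (w₂ · u_{2e₂}(x⁻¹) · w₂)` in `U(J₄)(R)` — `(0 1; 1 x) = (1 x⁻¹; 0 1)(−x⁻¹ 0; 0 x)(1 0; x⁻¹ 1)` in the
plane of `e₂, f₂`; the torus letter `t(1, −x⁻¹) = diag(1, −x⁻¹, σ(−x⁻¹)⁻¹ = x, 1)` uses `σ x = −x`. [cite: Casselman1980, §3] [cite: Rogawski1990, §1.9] -/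
theorem weylTwo_mul_uLongTwo_eq (hσ : ∀ y, σ (σ y) = y) (x : Rˣ) (hx : σ (x : R) = -(x : R)) :
    weylTwo R σ * uLongTwo R σ (x : R) hx =
      uLongTwo R σ ((x⁻¹ : Rˣ) : R) (skew_inv hx) * torusElt R σ hσ 1 (-x⁻¹) *
        (weylTwo R σ * uLongTwo R σ ((x⁻¹ : Rˣ) : R) (skew_inv hx) * weylTwo R σ) := by
  apply ext_of_coe
  simp only [Subgroup.coe_mul, Units.val_mul, coe_weylTwo, coe_uLongTwo, coe_torusElt]
  ext i j
  fin_cases i <;> fin_cases j <;>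
    simp [weylTwoM, uLongTwoM, torusM, Matrix.mul_apply, Fin.sum_univ_four, Units.val_neg, hx, Units.inv_mul, Units.mul_inv]

/-! ## §2 The opposite letter and the shift clause -/

/-- the opposite root letter `ū_{2e₂}(r) := w₂ u_{2e₂}(r) w₂` at `r = 0` is `1`. [cite: Casselman1980, §3] -/
theorem weylTwo_mul_uLongTwo_zero_mul_weylTwo :
    weylTwo R σ * uLongTwo R σ 0 (by rw [map_zero, neg_zero]) * weylTwo R σ = 1 := by
  rw [uLongTwo_zero, mul_one, weylTwo_mul_weylTwo]

/-- the opposite root letter is additive: `ū(r) ū(r′) = ū(r + r′)`. [cite: Casselman1980, §3] -/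
theorem opp_uLongTwo_mul (r r' : R) (hr : σ r = -r) (hr' : σ r' = -r') :
    (weylTwo R σ * uLongTwo R σ r hr * weylTwo R σ) * (weylTwo R σ * uLongTwo R σ r' hr' * weylTwo R σ) =
      weylTwo R σ * uLongTwo R σ (r + r') (by rw [map_add, hr, hr', neg_add]) * weylTwo R σ := by
  rw [show (weylTwo R σ * uLongTwo R σ r hr * weylTwo R σ) * (weylTwo R σ * uLongTwo R σ r' hr' * weylTwo R σ) =
      weylTwo R σ * uLongTwo R σ r hr * (weylTwo R σ * weylTwo R σ) * uLongTwo R σ r' hr' * weylTwo R σ by group,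
    weylTwo_mul_weylTwo, mul_one, mul_assoc (weylTwo R σ), uLongTwo_mul]

/-- **the shift clause**: `w₂ u(x) · u(b) = w₂ u(x + b)` (the integration variable is translated by elements of the same root group).
[cite: Casselman1980, §3] -/
theorem weylTwo_mul_uLongTwo_mul_uLongTwo (x b : R) (hx : σ x = -x) (hb : σ b = -b) :
    weylTwo R σ * uLongTwo R σ x hx * uLongTwo R σ b hb = weylTwo R σ * uLongTwo R σ (x + b) (by rw [map_add, hx, hb, neg_add]) := by
  rw [mul_assoc, uLongTwo_mul]

end Summit.HodgeConjecture.HodgeConjecture.Cruxes.HLiu418.K2LiuDoubledUTwoTwoRankOneRelations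

end
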